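import Summits.AtomisticToContinuum.HydrodynamicLimit.Theorems.RelayRaceLocalityNearConstantShortTimeHLGeneralFamilyConcentrationContraction
import Summits.AtomisticToContinuum.HydrodynamicLimit.Theorems.OneFlightGossipEngineUniformLocalGibbsConcentrationDensity
import HarnessLib

/-!
# General `(ε_N, n_N)` families of the canonical hard-sphere gas, III: the one-point limit and exponential
concentration of the density field

Support file for the crux `…Theses.RelayRaceLocality.NearConstantShortTimeHL` (stmt-AtomisticToContinuum-12502),
line `means-pin-entropy`, registered stub `stub_concentrationGeneralFamilies : GeneralFamilyConcentration`.
Along a general family (`ε_N > 0`, `ε_N → 0`, `n_N ε_N³ → σ³`):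

* `gf_tendsto_onePt` — the one-point expectation of the canonical gas of the profile `P` converges to the SAME
  cluster-series limit as along the conjunct scaling: `M^χ_{ε_N,n_N}(n_N)/Ξ_{ε_N,n_N}(n_N) → Ilim P σ χ`
  (decorated expansion in size form, parts I–II, Tannery's theorem);
* `gf_eventually_upperTail_le` — the one-sided exponential Chebyshev bound with the tilted profile
  (`UniformLGC.canonical_tail_le`, general in `(ε, n)`) and the profile-Lipschitz bound `UniformLGC.abs_Ilim_sub_le`
  give `ν_N{n_N(I+δ) ≤ ∑χ(xᵢ)} ≤ e^{-r n_N}` for `N ≥ N₀`, `I = Ilim P σ χ`;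
* `gf_exists_const_of_eventually`, `gf_canonical_le_one` — packaging of two rates and finitely many early `N`
  (where the canonical law is still a sub-probability) into `K e^{-n_N/K}`;
* `gf_density_concentration` — `ν_N{δ < |n_N⁻¹∑χ(xᵢ) - Ilim P σ χ|} ≤ K e^{-n_N/K}` for ALL `N`, under the
  uniform smallness `e · 2M · v₁ σ³ ≤ 1/32` of the proved conjunct-family theorem (item 14445).

No definitions. Sources: E. Pulvirenti – D. Tsagkarogiannis, Comm. Math. Phys. 316 (2012) Thm 2.1;
C. Kipnis – C. Landim, Scaling Limits of Interacting Particle Systems (1999), App. 2 (exponential Chebyshev).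
-/

noncomputable section

namespace Summit.AtomisticToContinuum.HydrodynamicLimit.Theorems.NearConstantShortTimeHL

open MeasureTheory ProbabilityTheory Finset Filter Topology
open scoped ENNReal
open Literature.MathematicalPhysics.KineticTheory Literature.MathematicalPhysics.StatisticalMechanics
open Literature.Probability.LatticeModels
open Summit.AtomisticToContinuum.HydrodynamicLimit.Theorems.UniformLGC

/-! ### The one-point limit along a general family -/

section OnePoint

variable {P : DensityProfile} {σ lam : ℝ} {ε : ℕ → ℝ} {n : ℕ → ℕ}

/-- **The one-point limit along a general family.** For a profile in the statics regime with slack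
(`SmallDensity P σ`, `ovDensity P σ < λ`, `2eλ ≤ 1/14`) and bounded measurable `χ`:
`M^χ_{ε_N,n_N}(n_N) / Ξ_{ε_N,n_N}(n_N) → Ilim P σ χ = ∑_j γ_j (∫χβ^{j+1}) R^{j+1}` — the decorated expansion in size
form `M^χ(n) = ∑_{j<n} C(n-1,j) W^χ(j+1) Ξ(n-1-j)`, the limits of parts I–II and Tannery's theorem. [folklore] -/
theorem gf_tendsto_onePt [∀ N, NeZero (n N)] (hP : SmallDensity P σ) (hlamσ : ovDensity P σ < lam)
    (hlam : 2 * Real.exp 1 * lam ≤ 1 / 14) (hε0 : ∀ N, 0 < ε N) (hε : Tendsto ε atTop (𝓝 0))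
    (hn : Tendsto (fun N => (n N : ℝ) * ε N ^ 3) atTop (𝓝 (σ ^ 3)))
    {χ : T3 → ℝ} (hχ : Measurable χ) {C : ℝ} (hχC : ∀ y, |χ y| ≤ C) :
    Tendsto (fun N => Md P (ε N) (n N) χ (n N) / Xi P (ε N) (n N) (n N)) atTop (𝓝 (Ilim P σ χ)) := by
  have hC : 0 ≤ C := (abs_nonneg _).trans (hχC 0)
  have he0 : 0 < Real.exp 1 := Real.exp_pos 1
  have hlam0 : 0 ≤ lam := hP.ovDensity_nonneg.trans hlamσ.le
  obtain ⟨hθ1, hlam2, -, -⟩ := gf_slack_numerics hlam0 hlam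
  have hlam1 : lam < 1 := by linarith
  set θ := 2 * Real.exp 1 * lam with hθdef
  have hθ0 : 0 ≤ θ := by positivity
  set F : ℕ → ℕ → ℝ := fun N j =>
    if j < n N then (((n N - 1).choose j : ℝ) * Wd P (ε N) (n N) χ (j + 1)) *
      (Xi P (ε N) (n N) (n N - (j + 1)) / Xi P (ε N) (n N) (n N)) else 0 with hF
  -- the expansion
  have hF_eq : ∀ N, ∑' j, F N j = Md P (ε N) (n N) χ (n N) / Xi P (ε N) (n N) (n N) := by
    intro N
    have hn1 : 1 ≤ n N := Nat.pos_of_ne_zero (NeZero.ne _)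
    rw [tsum_eq_sum (s := range (n N)) (fun j hj => by
      rw [hF]; dsimp only; rw [if_neg (fun h' => hj (mem_range.mpr h'))])]
    rw [Md_eq_sum hχ hχC hn1 le_rfl, sum_div]
    refine sum_congr rfl fun j hj => ?_
    have hj' := mem_range.mp hj
    rw [hF]; dsimp only; rw [if_pos hj', show n N - 1 - j = n N - (j + 1) by omega]
    ring
  -- termwise convergence
  have hF_lim : ∀ j, Tendsto (fun N => F N j) atTop (𝓝 (coefLim P σ χ j * ratioLimit P σ ^ (j + 1))) := by
    intro j
    have h1 := gf_tendsto_coef P hP.σ_pos hε0 hε hn 0 j hχ hχC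
    have h2 := gf_tendsto_r hP hlamσ hlam hε0 hε hn 0 (j + 1)
    simp only [Nat.sub_zero] at h1 h2
    have hlim := h1.mul h2
    refine hlim.congr' ?_
    filter_upwards [(gf_tendsto_atTop hP.σ_pos hε0 hε hn).eventually_ge_atTop (j + 1)] with N hN
    rw [hF]; dsimp only; rw [if_pos (by omega)]
  -- domination
  have hF_bound : ∀ᶠ N in atTop, ∀ j, ‖F N j‖ ≤ 2 * C * Real.exp 1 * θ ^ j := by
    filter_upwards [gf_eventually_small hlamσ hε hn] with N ⟨hN4, hN5⟩ j
    rw [Real.norm_eq_abs, hF]; dsimp only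
    split_ifs with hj
    · have hco := gf_abs_coef_le (hε0 N).le hN4 hN5 hχ hχC (m := n N - 1) hj (Nat.sub_le _ _)
      have hr0 : 0 ≤ Xi P (ε N) (n N) (n N - (j + 1)) / Xi P (ε N) (n N) (n N) :=
        zero_le_one.trans (gf_one_le_r (hε0 N).le hN4 hN5 hlam1 le_rfl (by omega))
      have hr2 : Xi P (ε N) (n N) (n N - (j + 1)) / Xi P (ε N) (n N) (n N) ≤ 2 ^ (j + 1) :=
        gf_r_le_two_pow (hε0 N).le hN4 hN5 hlam1 hlam2 le_rfl (by omega)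
      rw [abs_mul, abs_of_nonneg hr0]
      calc |((n N - 1).choose j : ℝ) * Wd P (ε N) (n N) χ (j + 1)| *
            (Xi P (ε N) (n N) (n N - (j + 1)) / Xi P (ε N) (n N) (n N))
          ≤ (C * (Real.exp 1 * (Real.exp 1 * lam) ^ j)) * 2 ^ (j + 1) :=
            mul_le_mul hco hr2 hr0 (by positivity)
        _ = 2 * C * Real.exp 1 * θ ^ j := by rw [hθdef, pow_succ, mul_pow, mul_pow]; ring
    · rw [abs_zero]; positivity
  have hsum : Summable fun j : ℕ => 2 * C * Real.exp 1 * θ ^ j :=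
    (summable_geometric_of_lt_one hθ0 hθ1).mul_left _
  have hT := tendsto_tsum_of_dominated_convergence hsum hF_lim hF_bound
  rw [Ilim]
  exact hT.congr hF_eq

end OnePoint

/-! ### The one-sided bound, eventually in `N` -/

section OneSided

variable {P : DensityProfile} {σ : ℝ} {ε : ℕ → ℝ} {n : ℕ → ℕ}

/-- **Upper tail, eventually, along a general family.** Under the uniform smallness `e · 2M · v₁ · σ³ ≤ 1/32`, for
continuous `|χ| ≤ C` and `δ > 0` there are a rate `r > 0` and `N₀` such that for `N ≥ N₀` the canonical law of `n_N`
spheres of diameter `ε_N` gives `{n_N (I + δ) ≤ ∑ χ(xᵢ)}` mass `≤ e^{-r n_N}`, `I = Ilim P σ χ`. [folklore] -/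
theorem gf_eventually_upperTail_le [∀ N, NeZero (n N)] (hσ : 0 < σ) (hσ2 : σ < 1 / 2)
    (hsmall : Real.exp 1 * (2 * P.M * v₁ * σ ^ 3) ≤ 1 / 32) (hε0 : ∀ N, 0 < ε N)
    (hε : Tendsto ε atTop (𝓝 0)) (hn : Tendsto (fun N => (n N : ℝ) * ε N ^ 3) atTop (𝓝 (σ ^ 3)))
    {χ : T3 → ℝ} (hχ : Continuous χ) {C : ℝ} (hC : 0 < C) (hχC : ∀ y, |χ y| ≤ C) {δ : ℝ} (hδ : 0 < δ) :
    ∃ r : ℝ, 0 < r ∧ ∃ N₀ : ℕ, ∀ N : ℕ, N₀ ≤ N →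
      (ENNReal.ofReal (Xi P (ε N) (n N) (n N))⁻¹ •
          (Measure.pi fun _ : Fin (n N) => P.μ).restrict (hardCoreSet (Ov (ε N)) univ))
        {x | (n N : ℝ) * (Ilim P σ χ + δ) ≤ ∑ i, χ (x i)} ≤
      ENNReal.ofReal (Real.exp (-(r * (n N : ℝ)))) := by
  set Mstar := 2 * P.M with hMstar
  set η := Real.exp 1 * (Mstar * v₁ * σ ^ 3) with hηdef
  have hη : η ≤ 1 / 32 := by rw [hηdef, hMstar]; exact hsmall
  have hM := P.M_pos
  have hv := v₁_pos
  have hMP : P.M ≤ Mstar := by rw [hMstar]; linarith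
  have hP : SmallDensity P σ := smallDensity_of_eta_le hσ hσ2 hMP hη
  have he0 : 0 < Real.exp 1 := Real.exp_pos 1
  have hη0 : 0 ≤ η := by positivity
  have h2η : 0 < 1 - 2 * η := by linarith
  -- the slack parameter `λ = (8/7) M⋆ v₁ σ³`: `ovDensity X σ < λ` whenever `X.M ≤ M⋆`, and `2eλ = (16/7) η ≤ 1/14`
  set lam := 8 / 7 * (Mstar * v₁ * σ ^ 3) with hlamdef
  have hlam : 2 * Real.exp 1 * lam ≤ 1 / 14 := by
    rw [hlamdef, show 2 * Real.exp 1 * (8 / 7 * (Mstar * v₁ * σ ^ 3)) = 16 / 7 * η by rw [hηdef]; ring]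
    linarith
  have hlamX : ∀ X : DensityProfile, X.M ≤ Mstar → ovDensity X σ < lam := by
    intro X hX
    have h0 : 0 < Mstar * v₁ * σ ^ 3 := by positivity
    calc ovDensity X σ = X.M * (v₁ * σ ^ 3) := by rw [ovDensity]; ring
      _ ≤ Mstar * (v₁ * σ ^ 3) := mul_le_mul_of_nonneg_right hX (by positivity)
      _ = Mstar * v₁ * σ ^ 3 := by ring
      _ < lam := by rw [hlamdef]; linarith
  -- the Lipschitz constant of `Q ↦ Ilim Q σ χ`
  set L := Real.exp 1 * C * (2 + 4 * (Real.exp 1 / (1 - 2 * η) ^ 2)) / (1 - 2 * η) ^ 2 with hL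
  have hL0 : 0 < L := by positivity
  -- the tilt parameter
  set t := min (1 / (4 * C)) (δ / (12 * L * P.M * C)) with ht
  have ht0 : 0 < t := lt_min (by positivity) (by positivity)
  have htC : 2 * t * C ≤ 1 / 2 := by
    have : t ≤ 1 / (4 * C) := min_le_left _ _
    rw [le_div_iff₀ (by positivity)] at this; linarith
  have htδ : 12 * L * P.M * C * t ≤ δ := by
    have : t ≤ δ / (12 * L * P.M * C) := min_le_right _ _
    rwa [le_div_iff₀ (by positivity), mul_comm] at this
  -- the tilted profile
  obtain ⟨Q, hQ⟩ := exists_tilt P hχ t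
  have habs : |t| = t := abs_of_pos ht0
  have hexp2 : Real.exp (2 * |t| * C) ≤ 2 := by
    rw [habs]
    exact ((Real.exp_le_exp.2 htC).trans exp_half_lt_two.le)
  have hMQ : Q.M ≤ Mstar := by
    refine (tilt_M_le hχ hχC hQ).trans ?_
    rw [hMstar]; nlinarith
  have hQs : SmallDensity Q σ := smallDensity_of_eta_le hσ hσ2 hMQ hη
  set ω := P.M * (Real.exp (2 * |t| * C) - 1) with hω
  have hωβ : ∀ y, |Q.β y - P.β y| ≤ ω := abs_tilt_sub_le hχ hχC hQ
  have hωle : ω ≤ 4 * P.M * t * C := by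
    have h1 : |2 * t * C| ≤ 1 := by rw [abs_of_nonneg (by positivity)]; linarith
    have h2 := Real.abs_exp_sub_one_le h1
    rw [abs_of_nonneg (by positivity : (0 : ℝ) ≤ 2 * t * C)] at h2
    have h3 : Real.exp (2 * |t| * C) - 1 ≤ 2 * (2 * t * C) := by rw [habs]; exact (le_abs_self _).trans h2
    rw [hω]; nlinarith
  have hIlim : |Ilim Q σ χ - Ilim P σ χ| ≤ δ / 3 := by
    have h1 := abs_Ilim_sub_le hP hQs hMP hMQ hη hωβ hχ hχC
    have h2 : Real.exp 1 * C * (2 * ω + 4 * (Real.exp 1 * ω / (1 - 2 * η) ^ 2)) / (1 - 2 * η) ^ 2 = L * ω := by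
      rw [hL]; ring
    rw [h2] at h1
    have h3 : L * ω ≤ L * (4 * P.M * t * C) := mul_le_mul_of_nonneg_left hωle hL0.le
    linarith
  -- the one-point limit for the tilted profile, along the general family
  have hlim := gf_tendsto_onePt hQs (hlamX Q hMQ) hlam hε0 hε hn hχ.measurable hχC
  rw [Metric.tendsto_atTop] at hlim
  obtain ⟨N₁, hN₁⟩ := hlim (δ / 3) (by positivity)
  -- positivity of the partition functions of `P`, eventually
  obtain ⟨N₂, hN₂⟩ := eventually_atTop.1 (gf_eventually_small (hlamX P hMP) hε hn)
  have hlam0 : 0 ≤ lam := hP.ovDensity_nonneg.trans (hlamX P hMP).le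
  obtain ⟨hθ1, hlam2, -, -⟩ := gf_slack_numerics hlam0 hlam
  have hlam1 : lam < 1 := by linarith
  refine ⟨t * δ / 3, by positivity, max N₁ N₂, fun N hN => ?_⟩
  have hone := hN₁ N (le_of_max_le_left hN)
  obtain ⟨hN4, hN5⟩ := hN₂ N (le_of_max_le_right hN)
  rw [Real.dist_eq] at hone
  have hXiP : 0 < Xi P (ε N) (n N) (n N) := gf_Xi_pos (hε0 N).le hN4 hN5 hlam1 le_rfl
  have htail := canonical_tail_le (ε N) (n := n N) hχ hχC hQ ht0 hXiP (Ilim P σ χ + δ)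
  refine htail.trans (ENNReal.ofReal_le_ofReal (Real.exp_le_exp.2 ?_))
  have key : Md Q (ε N) (n N) χ (n N) / Xi Q (ε N) (n N) (n N) - (Ilim P σ χ + δ) ≤ -(δ / 3) := by
    have := abs_lt.1 hone
    have := abs_le.1 hIlim
    linarith [this.2]
  calc (n N : ℝ) * t * (Md Q (ε N) (n N) χ (n N) / Xi Q (ε N) (n N) (n N) - (Ilim P σ χ + δ))
      ≤ (n N : ℝ) * t * (-(δ / 3)) := mul_le_mul_of_nonneg_left key (by positivity)
    _ = -(t * δ / 3 * (n N : ℝ)) := by ring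

end OneSided

/-! ### The two-sided bound for all `N` -/

section TwoSided

variable {P : DensityProfile} {σ : ℝ} {ε : ℕ → ℝ} {n : ℕ → ℕ}

/-- The canonical law of `n` hard spheres at any scale is a sub-probability: `ν(A) ≤ 1` (if `Ξ(n) = 0` the
restricted product law vanishes and so does `Ξ(n)⁻¹ · 0`). [folklore] -/
theorem gf_canonical_le_one (P : DensityProfile) (e : ℝ) (m : ℕ) (A : Set (Fin m → T3)) :
    (ENNReal.ofReal (Xi P e m m)⁻¹ •
        (Measure.pi fun _ : Fin m => P.μ).restrict (hardCoreSet (Ov e) univ)) A ≤ 1 := by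
  set ρ := (Measure.pi fun _ : Fin m => P.μ).restrict (hardCoreSet (Ov e) univ) with hρ
  have huniv : ρ.real Set.univ = Xi P e m m := by
    rw [hρ, measureReal_restrict_apply_univ, Xi, firstLabels_self]; rfl
  have hle : (ENNReal.ofReal (Xi P e m m)⁻¹ • ρ) A ≤ (ENNReal.ofReal (Xi P e m m)⁻¹ • ρ) Set.univ :=
    measure_mono (Set.subset_univ _)
  refine hle.trans ?_
  rw [Measure.smul_apply, smul_eq_mul, ← ofReal_measureReal (measure_ne_top ρ _), huniv,
    ← ENNReal.ofReal_mul (inv_nonneg.2 (Xi_nonneg _)), ← ENNReal.ofReal_one]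
  refine ENNReal.ofReal_le_ofReal ?_
  by_cases hXi : Xi P e m m = 0
  · rw [hXi, mul_zero]; exact zero_le_one
  · rw [inv_mul_cancel₀ hXi]

/-- Packaging two exponential rates in a general size parameter `m_N` and finitely many exceptional `N` into one
constant: if `p N ≤ 1` always and `p N ≤ e^{-r₁ m_N} + e^{-r₂ m_N}` for `N ≥ N₀`, then `p N ≤ K e^{-m_N/K}` for all `N`
with `K = ∑_{N<N₀} m_N + 3 + r₁⁻¹ + r₂⁻¹`. [folklore] -/
theorem gf_exists_const_of_eventually {p : ℕ → ℝ≥0∞} (hp1 : ∀ N, p N ≤ 1) (m : ℕ → ℕ) {r₁ r₂ : ℝ} (hr₁ : 0 < r₁)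
    (hr₂ : 0 < r₂) {N₀ : ℕ} (hev : ∀ N, N₀ ≤ N →
      p N ≤ ENNReal.ofReal (Real.exp (-(r₁ * (m N : ℝ)))) + ENNReal.ofReal (Real.exp (-(r₂ * (m N : ℝ))))) :
    ∃ K : ℝ, 0 < K ∧ ∀ N : ℕ, p N ≤ ENNReal.ofReal (K * Real.exp (-(K⁻¹ * (m N : ℝ)))) := by
  set B : ℝ := ∑ N ∈ range N₀, (m N : ℝ) with hB
  have hB0 : 0 ≤ B := sum_nonneg fun N _ => Nat.cast_nonneg _
  set K : ℝ := B + 3 + r₁⁻¹ + r₂⁻¹ with hK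
  have hr₁' : 0 < r₁⁻¹ := inv_pos.2 hr₁
  have hr₂' : 0 < r₂⁻¹ := inv_pos.2 hr₂
  have hK3 : 3 ≤ K := by rw [hK]; linarith
  have hK0 : 0 < K := by linarith
  have hKr₁ : K⁻¹ ≤ r₁ := by rw [inv_le_comm₀ hK0 hr₁, hK]; linarith
  have hKr₂ : K⁻¹ ≤ r₂ := by rw [inv_le_comm₀ hK0 hr₂, hK]; linarith
  refine ⟨K, hK0, fun N => ?_⟩
  have hn : (0 : ℝ) ≤ (m N : ℝ) := Nat.cast_nonneg _
  by_cases hN : N₀ ≤ N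
  · refine (hev N hN).trans ?_
    rw [← ENNReal.ofReal_add (Real.exp_pos _).le (Real.exp_pos _).le]
    refine ENNReal.ofReal_le_ofReal ?_
    have h1 : Real.exp (-(r₁ * (m N : ℝ))) ≤ Real.exp (-(K⁻¹ * (m N : ℝ))) := by
      rw [Real.exp_le_exp]; nlinarith
    have h2 : Real.exp (-(r₂ * (m N : ℝ))) ≤ Real.exp (-(K⁻¹ * (m N : ℝ))) := by
      rw [Real.exp_le_exp]; nlinarith
    have h3 : 0 < Real.exp (-(K⁻¹ * (m N : ℝ))) := Real.exp_pos _
    nlinarith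
  · push Not at hN
    refine (hp1 N).trans ?_
    rw [← ENNReal.ofReal_one]
    refine ENNReal.ofReal_le_ofReal ?_
    have hmB : (m N : ℝ) ≤ B :=
      single_le_sum (f := fun N => (m N : ℝ)) (fun N _ => Nat.cast_nonneg _) (mem_range.2 hN)
    have hnK : K⁻¹ * (m N : ℝ) ≤ 1 := by
      rw [inv_mul_le_iff₀ hK0, hK]
      linarith
    have h1 : Real.exp (-1) ≤ Real.exp (-(K⁻¹ * (m N : ℝ))) := Real.exp_le_exp.2 (by linarith)
    have h2 : (1 : ℝ) ≤ 3 * Real.exp (-1) := by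
      rw [Real.exp_neg, le_mul_inv_iff₀ (Real.exp_pos 1)]
      linarith [Real.exp_one_lt_d9]
    have h3 : 0 < Real.exp (-1) := Real.exp_pos _
    nlinarith

/-- **Exponential concentration of the density field along a general family.** For a density profile `P` and
`0 < σ < 1/2` with `e · 2M · v₁ · σ³ ≤ 1/32`, a family `ε_N > 0`, `ε_N → 0`, `1 ≤ n_N`, `n_N ε_N³ → σ³`, every
continuous `χ` and `δ > 0` admit `K > 0` with `ν_N {δ < |n_N⁻¹ ∑ χ(xᵢ) - Ilim P σ χ|} ≤ K e^{-n_N/K}` for ALL `N`,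
where `ν_N = Ξ⁻¹ μ_P^{⊗n_N}|_H` is the canonical law of `n_N` hard spheres of diameter `ε_N` on `𝕋³`. [folklore] -/
theorem gf_density_concentration (hσ : 0 < σ) (hσ2 : σ < 1 / 2)
    (hsmall : Real.exp 1 * (2 * P.M * v₁ * σ ^ 3) ≤ 1 / 32) (hε0 : ∀ N, 0 < ε N)
    (hε : Tendsto ε atTop (𝓝 0)) (hn1 : ∀ N, 1 ≤ n N)
    (hn : Tendsto (fun N => (n N : ℝ) * ε N ^ 3) atTop (𝓝 (σ ^ 3))) {χ : T3 → ℝ} (hχ : Continuous χ)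
    {δ : ℝ} (hδ : 0 < δ) :
    ∃ K : ℝ, 0 < K ∧ ∀ N : ℕ,
      (ENNReal.ofReal (Xi P (ε N) (n N) (n N))⁻¹ •
          (Measure.pi fun _ : Fin (n N) => P.μ).restrict (hardCoreSet (Ov (ε N)) univ))
        {x | δ < |(n N : ℝ)⁻¹ * ∑ i, χ (x i) - Ilim P σ χ|} ≤
      ENNReal.ofReal (K * Real.exp (-(K⁻¹ * (n N : ℝ)))) := by
  haveI : ∀ N, NeZero (n N) := fun N => ⟨by have := hn1 N; omega⟩
  obtain ⟨C', hC'0, hχC'⟩ := exists_forall_abs_le_of_continuous hχ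
  set C := C' + 1 with hC
  have hC0 : 0 < C := by rw [hC]; linarith
  have hχC : ∀ y, |χ y| ≤ C := fun y => (hχC' y).trans (by rw [hC]; linarith)
  have hχn : Continuous fun y => -χ y := hχ.neg
  have hχnC : ∀ y, |(-χ y)| ≤ C := fun y => by rw [abs_neg]; exact hχC y
  obtain ⟨r₁, hr₁, N₁, h₁⟩ := gf_eventually_upperTail_le hσ hσ2 hsmall hε0 hε hn hχ hC0 hχC hδ
  obtain ⟨r₂, hr₂, N₂, h₂⟩ := gf_eventually_upperTail_le hσ hσ2 hsmall hε0 hε hn hχn hC0 hχnC hδ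
  rw [Ilim_neg] at h₂
  refine gf_exists_const_of_eventually (fun N => gf_canonical_le_one P (ε N) (n N) _) n hr₁ hr₂ (N₀ := max N₁ N₂)
    fun N hN => ?_
  have hN₁ : N₁ ≤ N := le_of_max_le_left hN
  have hN₂ : N₂ ≤ N := le_of_max_le_right hN
  refine le_trans (measure_mono fun x hx => ?_) ((measure_union_le _ _).trans (add_le_add (h₁ N hN₁) (h₂ N hN₂)))
  -- the deviation event is contained in the union of the two tail events
  simp only [Set.mem_setOf_eq, Set.mem_union] at hx ⊢
  have hnpos : (0 : ℝ) < (n N : ℝ) := by exact_mod_cast hn1 N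
  set S := ∑ i, χ (x i) with hS
  have hS' : ∑ i, -χ (x i) = -S := by rw [hS, sum_neg_distrib]
  rw [hS']
  rcases lt_abs.1 hx with h | h
  · left
    have : Ilim P σ χ + δ < (n N : ℝ)⁻¹ * S := by linarith
    rw [lt_inv_mul_iff₀ hnpos] at this
    linarith
  · right
    have : (n N : ℝ)⁻¹ * S < Ilim P σ χ - δ := by linarith
    rw [inv_mul_lt_iff₀ hnpos] at this
    linarith

end TwoSided

/-! ### Registered helper -/

/-- **Registered helper `gf_helper_density`** (sub-goal of `stub_concentrationGeneralFamilies`): exponential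
concentration of the density field of the canonical hard-sphere gas along a general family, `gf_density_concentration`
in closed form. [folklore] -/
theorem gf_helper_density :
    ∀ {P : Literature.MathematicalPhysics.KineticTheory.DensityProfile} {σ : ℝ} {ε : ℕ → ℝ} {n : ℕ → ℕ},
      0 < σ → σ < 1 / 2 →
      Real.exp 1 * (2 * P.M * Literature.MathematicalPhysics.KineticTheory.v₁ * σ ^ 3) ≤ 1 / 32 →
      (∀ N, 0 < ε N) → Filter.Tendsto ε Filter.atTop (nhds 0) → (∀ N, 1 ≤ n N) →
      Filter.Tendsto (fun N => (n N : ℝ) * ε N ^ 3) Filter.atTop (nhds (σ ^ 3)) →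
      ∀ {χ : Literature.MathematicalPhysics.KineticTheory.T3 → ℝ}, Continuous χ → ∀ {δ : ℝ}, 0 < δ →
      ∃ K : ℝ, 0 < K ∧ ∀ N : ℕ,
        (ENNReal.ofReal (Literature.MathematicalPhysics.KineticTheory.Xi P (ε N) (n N) (n N))⁻¹ •
            (MeasureTheory.Measure.pi fun _ : Fin (n N) => P.μ).restrict
              (Literature.MathematicalPhysics.StatisticalMechanics.hardCoreSet
                (Literature.MathematicalPhysics.KineticTheory.Ov (ε N)) Finset.univ))
          {x | δ < |(n N : ℝ)⁻¹ * ∑ i, χ (x i) - Literature.MathematicalPhysics.KineticTheory.Ilim P σ χ|} ≤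
        ENNReal.ofReal (K * Real.exp (-(K⁻¹ * (n N : ℝ)))) :=
  fun hσ hσ2 hsmall hε0 hε hn1 hn _ hχ _ hδ => gf_density_concentration hσ hσ2 hsmall hε0 hε hn1 hn hχ hδ

end Summit.AtomisticToContinuum.HydrodynamicLimit.Theorems.NearConstantShortTimeHL

end
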